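import Summits.QuantumFields.BalabanUV.T4Continuum.Support.UnitaryRootInterpolation

/-!
# T⁴ programme, node NE3 — kinematic refinement lemma, crew row S4d, file F1b: THE TWO-POINT GEODESIC
# `geo s b₀ b₁ = b₀ · (b₀⁻¹ b₁)^s` ON UNITS — the «even L-th-root rows» of the cell-by-cell filling

NE3 formalisation swarm `b2b-balaban-t4-ne3-formalise-*`, LEAF PROVER 07 (unit `b2b-balaban-t4-ne3-formalise-leaf-07`),
crew row **S4d** of `HOME/t4/formal/NE3/LEAVES.md` (item (s4d) R1c∕R1d of the row-owner skeleton
`HOME/t4/b2b-balaban-t4-ne3-p1/SKELETON-NE3-P1.md` v1.1 §2 ¶3 ∕ §6).  Continuation of `UnitaryRootInterpolation` (fractional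
powers `upow s R = exp (s • mlog R)`), split off for the 400-line rule: every row of the covariant cell filling (2-cells with
`L²`-th roots, m-cells with `L`-th roots) interpolates between two unit-valued bond variables `b₀` (height `0`) and `b₁`
(height `L`) along `t ↦ geo (t∕L) b₀ b₁ = b₀ (b₀⁻¹ b₁)^{t∕L}`.

CONTENT (all [folklore]; 0 sorry): §3 the unit `upowUnit s R` (tree `expUnit`; `upowUnit_one = R`, `upowUnit_add`,
`upowUnit_inv`) and the geodesic `geo`: endpoints `geo 0 = b₀`, `geo 1 = b₁`, EQUAL RATIOS
`(geo s)⁻¹ · geo (s + s′) = upowUnit s′ (b₀⁻¹b₁)` (the ratio of consecutive points of a row does not depend on the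
position: «even rows»), the row form `geo ((t+1)∕L) = geo (t∕L) · (b₀⁻¹b₁)^{1∕L}`, `geo (L∕L) = b₁`, CONJUGATION
`geo s (u b₀ v⁻¹) (u b₁ v⁻¹) = u · geo s b₀ b₁ · v⁻¹` (gauge covariance at both endpoints of the bond); §4 between
unitaries of a C⋆-algebra: `‖b₀⁻¹b₁ − 1‖ = ‖b₁ − b₀‖`, `‖b₀⁻¹b₁ − b₀′⁻¹b₁′‖ ≤ ‖b₀ − b₀′‖ + ‖b₁ − b₁′‖`, the geodesic is
UNITARY (`‖b₁ − b₀‖ ≤ 1∕4`), DEVIATIONS `‖geo s − b₀‖ ≤ 4|s|‖b₁ − b₀‖`, `‖geo s − b₁‖ ≤ 4|1−s|‖b₁ − b₀‖`, the ROW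
INCREMENT `‖(b₀⁻¹b₁)^{1∕L} − 1‖ ≤ 4‖b₁ − b₀‖∕L`, and the ENDPOINT-LIPSCHITZ bound
`‖geo s b₀ b₁ − geo s b₀′ b₁′‖ ≤ 7(‖b₀ − b₀′‖ + ‖b₁ − b₁′‖)` (`‖b₁ − b₀‖ ≤ 1∕2`, `‖b₁′ − b₀′‖ ≤ 1∕4`, `|s| ≤ 1`) — the
estimate behind the fine flux GRADIENT bounds between neighbouring rows of a filled cell.

HONEST FRAMING.  Elementary functional analysis; nothing here mentions Bałaban's average (42), minimisers, or any
conditional of the cell (`BetaPertH`, (B), (B^μ)); **NE3 is NOT proved** — support for the kinematic lemma `SmoothRefine`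
(skeleton leaf R1), whose cell-filling rows S4b–S4e are open; nothing bears on infinite volume, a mass gap, or the Clay
problem (finite-T⁴ rung (B)+1 programme).  ABSOLUTE RULE of the cell kept: no printed sentence is a hypothesis of any
declaration; no `sorry`; axioms ⊆ {propext, Classical.choice, Quot.sound}.  Context citation only: T. Bałaban, Commun.
Math. Phys. **98** (1985) 17–51 [Balaban1985Averaging], (21)–(23) p. 21.  PLACEMENT (human rule 2026-08-19): our lemma
under `Summits/QuantumFields/BalabanUV/`; imports `Support/UnitaryRootInterpolation` only; moves nothing.  Records:
`HOME/t4/formal/NE3/LEAVES.md` row S4d; journal CLAIM NE3-S4d (CLAIMS.log l.7178).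
-/

set_option autoImplicit false

open NormedSpace

namespace Summit.QuantumFields.BalabanUV.T4Continuum.UnitaryGeodesic

open Literature.MathematicalPhysics.QuantumFieldTheory.Balaban1983to89
open MatrixLog B7Prop1Explicit B7Prop2Explicit UnitaryRootInterpolation

noncomputable section

/-! ## §3 The unit `upowUnit` and the two-point geodesic `geo` -/

section Units

variable {𝔸 : Type*} [NormedRing 𝔸] [NormedAlgebra ℂ 𝔸] [CompleteSpace 𝔸]

/-- `R^s` as a unit (inverse `exp(−s • log R)`; tree `expUnit`). [folklore] -/
def upowUnit (s : ℝ) (R : 𝔸) : 𝔸ˣ := expUnit (s • mlog R)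

/-- `↑(upowUnit s R) = upow s R`. [folklore] -/
@[simp] theorem val_upowUnit (s : ℝ) (R : 𝔸) : (upowUnit s R : 𝔸) = upow s R := rfl

/-- `upowUnit 0 R = 1`. [folklore] -/
@[simp] theorem upowUnit_zero (R : 𝔸) : upowUnit 0 R = 1 := by
  ext; simp

/-- `upowUnit 1 R = R` for a unit `R` with `‖R − 1‖ < 1`. [folklore] -/
theorem upowUnit_one {R : 𝔸ˣ} (hR : ‖(R : 𝔸) - 1‖ < 1) : upowUnit 1 (R : 𝔸) = R := by
  ext; simp [upow_one hR]

/-- `upowUnit (s + s′) R = upowUnit s R * upowUnit s′ R`. [folklore] -/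
theorem upowUnit_add (s s' : ℝ) (R : 𝔸) : upowUnit (s + s') R = upowUnit s R * upowUnit s' R := by
  ext; simp [upow_add]

/-- The inverse is the power with the opposite exponent. [folklore] -/
theorem upowUnit_inv (s : ℝ) (R : 𝔸) : (upowUnit s R)⁻¹ = upowUnit (-s) R := by
  rw [upowUnit, upowUnit, val_inv_expUnit, neg_smul]

/-- **THE TWO-POINT GEODESIC** `geo s b₀ b₁ := b₀ · (b₀⁻¹ b₁)^s` between the units `b₀` (at `s = 0`) and `b₁`
(at `s = 1`): the interpolant of every row of the cell filling. [folklore] -/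
def geo (s : ℝ) (b₀ b₁ : 𝔸ˣ) : 𝔸ˣ := b₀ * upowUnit s (((b₀⁻¹ * b₁ : 𝔸ˣ) : 𝔸))

/-- `geo s b₀ b₁ = b₀ * upowUnit s (b₀⁻¹ b₁)` (unfolding). [folklore] -/
theorem geo_def (s : ℝ) (b₀ b₁ : 𝔸ˣ) : geo s b₀ b₁ = b₀ * upowUnit s (((b₀⁻¹ * b₁ : 𝔸ˣ) : 𝔸)) := rfl

/-- `geo 0 b₀ b₁ = b₀`. [folklore] -/
@[simp] theorem geo_zero (b₀ b₁ : 𝔸ˣ) : geo 0 b₀ b₁ = b₀ := by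
  simp [geo]

/-- `geo 1 b₀ b₁ = b₁` when `‖b₀⁻¹b₁ − 1‖ < 1`. [folklore] -/
theorem geo_one {b₀ b₁ : 𝔸ˣ} (h : ‖((b₀⁻¹ * b₁ : 𝔸ˣ) : 𝔸) - 1‖ < 1) : geo 1 b₀ b₁ = b₁ := by
  rw [geo, upowUnit_one h, mul_inv_cancel_left]

/-- **EQUAL RATIOS** («even rows»): `geo (s + s′) = geo s · (b₀⁻¹b₁)^{s′}` — the ratio of consecutive points of a
row does not depend on the position `s`. [folklore] -/
theorem geo_add (s s' : ℝ) (b₀ b₁ : 𝔸ˣ) :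
    geo (s + s') b₀ b₁ = geo s b₀ b₁ * upowUnit s' (((b₀⁻¹ * b₁ : 𝔸ˣ) : 𝔸)) := by
  rw [geo, geo, upowUnit_add, mul_assoc]

/-- The ratio form: `(geo s)⁻¹ · geo (s + s′) = (b₀⁻¹b₁)^{s′}`. [folklore] -/
theorem geo_inv_mul_geo_add (s s' : ℝ) (b₀ b₁ : 𝔸ˣ) :
    (geo s b₀ b₁)⁻¹ * geo (s + s') b₀ b₁ = upowUnit s' (((b₀⁻¹ * b₁ : 𝔸ˣ) : 𝔸)) := by
  rw [geo_add, inv_mul_cancel_left]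

/-- The row of length `L`: `geo ((t+1)∕L) = geo (t∕L) · (b₀⁻¹b₁)^{1∕L}`. [folklore] -/
theorem geo_div_succ (L t : ℕ) (b₀ b₁ : 𝔸ˣ) :
    geo (((t + 1 : ℕ) : ℝ) / L) b₀ b₁ = geo ((t : ℝ) / L) b₀ b₁ * upowUnit (1 / (L : ℝ)) (((b₀⁻¹ * b₁ : 𝔸ˣ) : 𝔸)) := by
  rw [← geo_add]
  congr 1
  push_cast
  ring

/-- The row of length `L` ends at `b₁`: `geo (L∕L) = b₁` (`L ≥ 1`, `‖b₀⁻¹b₁ − 1‖ < 1`). [folklore] -/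
theorem geo_div_self {L : ℕ} (hL : L ≠ 0) {b₀ b₁ : 𝔸ˣ} (h : ‖((b₀⁻¹ * b₁ : 𝔸ˣ) : 𝔸) - 1‖ < 1) :
    geo ((L : ℝ) / L) b₀ b₁ = b₁ := by
  rw [div_self (Nat.cast_ne_zero.mpr hL), geo_one h]

/-- **CONJUGATION of the geodesic**: `geo s (u b₀ v⁻¹) (u b₁ v⁻¹) = u · geo s b₀ b₁ · v⁻¹` for
`v ∈ {‖v‖ ≤ 1, ‖v⁻¹‖ ≤ 1}` — the filling is covariant under gauge transformations at both endpoints of the bond.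
[folklore] -/
theorem geo_conj [NormOneClass 𝔸] (u : 𝔸ˣ) {v : 𝔸ˣ} (hv : v ∈ U1 𝔸) {b₀ b₁ : 𝔸ˣ}
    (h : ‖((b₀⁻¹ * b₁ : 𝔸ˣ) : 𝔸) - 1‖ < 1) (s : ℝ) :
    geo s (u * b₀ * v⁻¹) (u * b₁ * v⁻¹) = u * geo s b₀ b₁ * v⁻¹ := by
  have hratio : (u * b₀ * v⁻¹)⁻¹ * (u * b₁ * v⁻¹) = v * (b₀⁻¹ * b₁) * v⁻¹ := by group
  have h' : ‖((b₀⁻¹ : 𝔸ˣ) : 𝔸) * (b₁ : 𝔸) - 1‖ < 1 := by simpa using h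
  apply Units.ext
  simp only [geo, hratio, Units.val_mul, val_upowUnit]
  rw [upow_units_conj hv h' s]
  simp only [← mul_assoc, Units.inv_mul_cancel_right]

end Units

/-! ## §4 The geodesic between unitaries: unitarity, deviation from the endpoints, Lipschitz dependence -/

section UnitaryGeo

variable {𝔸 : Type*} [CStarAlgebra 𝔸]

/-- `upowUnit s R` is in the unitary subgroup for unitary `R` with `‖R − 1‖ ≤ 1∕4`. [folklore] -/
theorem upowUnit_mem_unitaryUnits {R : 𝔸ˣ} (hR : R ∈ unitaryUnits 𝔸) (h : ‖(R : 𝔸) - 1‖ ≤ 1 / 4) (s : ℝ) :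
    upowUnit s (R : 𝔸) ∈ unitaryUnits 𝔸 :=
  upow_mem_unitary hR h s

variable [Nontrivial 𝔸]

omit [Nontrivial 𝔸] in
/-- For unitaries the ratio `b₀⁻¹b₁` is as close to `1` as `b₁` is to `b₀`: `‖b₀⁻¹b₁ − 1‖ = ‖b₁ − b₀‖`. [folklore] -/
theorem norm_ratio_sub_one {b₀ : 𝔸ˣ} (h₀ : b₀ ∈ unitaryUnits 𝔸) (b₁ : 𝔸ˣ) :
    ‖((b₀⁻¹ * b₁ : 𝔸ˣ) : 𝔸) - 1‖ = ‖(b₁ : 𝔸) - b₀‖ := by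
  have hid : ((b₀⁻¹ * b₁ : 𝔸ˣ) : 𝔸) - 1 = ((b₀⁻¹ : 𝔸ˣ) : 𝔸) * ((b₁ : 𝔸) - b₀) := by
    rw [mul_sub, Units.val_mul, Units.inv_mul]
  rw [hid, CStarRing.norm_mem_unitary_mul _ ((unitaryUnits 𝔸).inv_mem h₀)]

/-- The difference of two ratios of unitaries: `‖b₀⁻¹b₁ − b₀′⁻¹b₁′‖ ≤ ‖b₀ − b₀′‖ + ‖b₁ − b₁′‖`. [folklore] -/
theorem norm_ratio_sub_ratio_le {b₀ b₁ b₀' b₁' : 𝔸ˣ} (h₀ : b₀ ∈ unitaryUnits 𝔸) (h₀' : b₀' ∈ unitaryUnits 𝔸)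
    (h₁' : b₁' ∈ unitaryUnits 𝔸) :
    ‖((b₀⁻¹ * b₁ : 𝔸ˣ) : 𝔸) - ((b₀'⁻¹ * b₁' : 𝔸ˣ) : 𝔸)‖ ≤ ‖(b₀ : 𝔸) - b₀'‖ + ‖(b₁ : 𝔸) - b₁'‖ := by
  have hi₀ : b₀⁻¹ ∈ unitaryUnits 𝔸 := (unitaryUnits 𝔸).inv_mem h₀
  have hi₀' : b₀'⁻¹ ∈ unitaryUnits 𝔸 := (unitaryUnits 𝔸).inv_mem h₀'
  -- `b₀⁻¹b₁ − b₀'⁻¹b₁' = b₀⁻¹(b₁ − b₁') + b₀⁻¹ (b₀' − b₀) b₀'⁻¹ b₁'`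
  have hid : ((b₀⁻¹ * b₁ : 𝔸ˣ) : 𝔸) - ((b₀'⁻¹ * b₁' : 𝔸ˣ) : 𝔸)
      = ((b₀⁻¹ : 𝔸ˣ) : 𝔸) * ((b₁ : 𝔸) - b₁')
        + ((b₀⁻¹ : 𝔸ˣ) : 𝔸) * (((b₀' : 𝔸) - b₀) * (((b₀'⁻¹ : 𝔸ˣ) : 𝔸) * (b₁' : 𝔸))) := by
    simp only [Units.val_mul, mul_sub, sub_mul, Units.mul_inv_cancel_left, Units.inv_mul_cancel_left]
    abel
  rw [hid]
  refine (norm_add_le _ _).trans ?_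
  rw [CStarRing.norm_mem_unitary_mul _ hi₀, CStarRing.norm_mem_unitary_mul _ hi₀, add_comm]
  gcongr
  calc ‖((b₀' : 𝔸) - b₀) * (((b₀'⁻¹ : 𝔸ˣ) : 𝔸) * (b₁' : 𝔸))‖
        ≤ ‖(b₀' : 𝔸) - b₀‖ * ‖((b₀'⁻¹ : 𝔸ˣ) : 𝔸) * (b₁' : 𝔸)‖ := norm_mul_le _ _
    _ = ‖(b₀ : 𝔸) - b₀'‖ := by
        rw [CStarRing.norm_mem_unitary_mul _ hi₀', CStarRing.norm_of_mem_unitary (mem_unitaryUnits.mp h₁'),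
          mul_one, norm_sub_rev]

omit [Nontrivial 𝔸] in
/-- **THE GEODESIC BETWEEN UNITARIES IS UNITARY** (for `‖b₁ − b₀‖ ≤ 1∕4`). [folklore] -/
theorem geo_mem_unitaryUnits {b₀ b₁ : 𝔸ˣ} (h₀ : b₀ ∈ unitaryUnits 𝔸) (h₁ : b₁ ∈ unitaryUnits 𝔸)
    (h : ‖(b₁ : 𝔸) - b₀‖ ≤ 1 / 4) (s : ℝ) : geo s b₀ b₁ ∈ unitaryUnits 𝔸 := by
  refine (unitaryUnits 𝔸).mul_mem h₀ (upowUnit_mem_unitaryUnits ?_ ?_ s)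
  · exact (unitaryUnits 𝔸).mul_mem ((unitaryUnits 𝔸).inv_mem h₀) h₁
  · rwa [norm_ratio_sub_one h₀]

omit [Nontrivial 𝔸] in
/-- **DEVIATION FROM THE INITIAL POINT**: `‖geo s b₀ b₁ − b₀‖ ≤ 4|s|·‖b₁ − b₀‖` for unitaries with
`‖b₁ − b₀‖ ≤ 1∕2` and `2|s|‖b₁ − b₀‖ ≤ 1`. [folklore] -/
theorem norm_geo_sub_left_le {b₀ b₁ : 𝔸ˣ} (h₀ : b₀ ∈ unitaryUnits 𝔸) (h : ‖(b₁ : 𝔸) - b₀‖ ≤ 1 / 2) {s : ℝ}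
    (hs : |s| * (2 * ‖(b₁ : 𝔸) - b₀‖) ≤ 1) :
    ‖(geo s b₀ b₁ : 𝔸) - b₀‖ ≤ 4 * |s| * ‖(b₁ : 𝔸) - b₀‖ := by
  have hR : ‖((b₀⁻¹ * b₁ : 𝔸ˣ) : 𝔸) - 1‖ ≤ ‖(b₁ : 𝔸) - b₀‖ := (norm_ratio_sub_one h₀ b₁).le
  have hid : (geo s b₀ b₁ : 𝔸) - b₀ = (b₀ : 𝔸) * (upow s (((b₀⁻¹ * b₁ : 𝔸ˣ) : 𝔸)) - 1) := by
    rw [geo, Units.val_mul, val_upowUnit, mul_sub, mul_one]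
  rw [hid, CStarRing.norm_mem_unitary_mul _ (mem_unitaryUnits.mp h₀)]
  exact norm_upow_sub_one_le_lin hR h hs

omit [Nontrivial 𝔸] in
/-- **DEVIATION FROM THE FINAL POINT**: `‖geo s b₀ b₁ − b₁‖ ≤ 4|1 − s|·‖b₁ − b₀‖` for unitaries with
`‖b₁ − b₀‖ ≤ 1∕4` and `2|1 − s|‖b₁ − b₀‖ ≤ 1` (`b₁ = geo s · (b₀⁻¹b₁)^{1−s}`). [folklore] -/
theorem norm_geo_sub_right_le {b₀ b₁ : 𝔸ˣ} (h₀ : b₀ ∈ unitaryUnits 𝔸) (h₁ : b₁ ∈ unitaryUnits 𝔸)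
    (h : ‖(b₁ : 𝔸) - b₀‖ ≤ 1 / 4) {s : ℝ} (hs : |1 - s| * (2 * ‖(b₁ : 𝔸) - b₀‖) ≤ 1) :
    ‖(geo s b₀ b₁ : 𝔸) - b₁‖ ≤ 4 * |1 - s| * ‖(b₁ : 𝔸) - b₀‖ := by
  set R : 𝔸 := ((b₀⁻¹ * b₁ : 𝔸ˣ) : 𝔸) with hRdef
  have hR : ‖R - 1‖ ≤ ‖(b₁ : 𝔸) - b₀‖ := (norm_ratio_sub_one h₀ b₁).le
  have hR4 : ‖R - 1‖ ≤ 1 / 4 := hR.trans h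
  have hRu : R ∈ unitary 𝔸 := (unitaryUnits 𝔸).mul_mem ((unitaryUnits 𝔸).inv_mem h₀) h₁
  -- `b₁ = b₀ · R^s · R^{1−s}`
  have hb₁ : (b₁ : 𝔸) = (b₀ : 𝔸) * upow s R * upow (1 - s) R := by
    rw [mul_assoc, ← upow_add, add_sub_cancel, upow_one (by linarith), hRdef, Units.val_mul,
      Units.mul_inv_cancel_left]
  have hid : (geo s b₀ b₁ : 𝔸) - b₁ = (b₀ : 𝔸) * upow s R * (1 - upow (1 - s) R) := by
    rw [hb₁, geo, Units.val_mul, val_upowUnit, ← hRdef, mul_sub, mul_one]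
  have hu : (b₀ : 𝔸) * upow s R ∈ unitary 𝔸 :=
    Submonoid.mul_mem _ (mem_unitaryUnits.mp h₀) (upow_mem_unitary hRu hR4 s)
  rw [hid, CStarRing.norm_mem_unitary_mul _ hu, norm_sub_rev]
  exact norm_upow_sub_one_le_lin hR (h.trans (by norm_num)) hs

omit [Nontrivial 𝔸] in
/-- **THE ROW INCREMENT**: consecutive points of the row of length `L ≥ 1` differ by the constant ratio
`(b₀⁻¹b₁)^{1∕L}`, which is within `4‖b₁ − b₀‖∕L` of `1` (for `‖b₁ − b₀‖ ≤ 1∕2`). [folklore] -/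
theorem norm_rowRatio_sub_one_le {b₀ b₁ : 𝔸ˣ} (h₀ : b₀ ∈ unitaryUnits 𝔸) (h : ‖(b₁ : 𝔸) - b₀‖ ≤ 1 / 2)
    {L : ℕ} (hL : 1 ≤ L) :
    ‖(upowUnit (1 / (L : ℝ)) (((b₀⁻¹ * b₁ : 𝔸ˣ) : 𝔸)) : 𝔸) - 1‖ ≤ 4 * ‖(b₁ : 𝔸) - b₀‖ / L := by
  rw [val_upowUnit]
  exact norm_upow_one_div_sub_one_le (norm_ratio_sub_one h₀ b₁).le h hL

/-- **LIPSCHITZ DEPENDENCE OF THE GEODESIC ON ITS ENDPOINTS** (for flux gradients between neighbouring rows):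
`‖geo s b₀ b₁ − geo s b₀′ b₁′‖ ≤ 7(‖b₀ − b₀′‖ + ‖b₁ − b₁′‖)` for unitaries with `‖b₁ − b₀‖ ≤ 1∕2`,
`‖b₁′ − b₀′‖ ≤ 1∕4`, `|s| ≤ 1`. [folklore] -/
theorem norm_geo_sub_geo_le {b₀ b₁ b₀' b₁' : 𝔸ˣ} (h₀ : b₀ ∈ unitaryUnits 𝔸) (h₀' : b₀' ∈ unitaryUnits 𝔸)
    (h₁' : b₁' ∈ unitaryUnits 𝔸) (h : ‖(b₁ : 𝔸) - b₀‖ ≤ 1 / 2) (h' : ‖(b₁' : 𝔸) - b₀'‖ ≤ 1 / 4) {s : ℝ}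
    (hs : |s| ≤ 1) :
    ‖(geo s b₀ b₁ : 𝔸) - geo s b₀' b₁'‖ ≤ 7 * (‖(b₀ : 𝔸) - b₀'‖ + ‖(b₁ : 𝔸) - b₁'‖) := by
  set R : 𝔸 := ((b₀⁻¹ * b₁ : 𝔸ˣ) : 𝔸) with hRdef
  set R' : 𝔸 := ((b₀'⁻¹ * b₁' : 𝔸ˣ) : 𝔸) with hR'def
  have hR : ‖R - 1‖ ≤ 1 / 2 := (norm_ratio_sub_one h₀ b₁).le.trans h
  have hR'4 : ‖R' - 1‖ ≤ 1 / 4 := (norm_ratio_sub_one h₀' b₁').le.trans h'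
  have hR' : ‖R' - 1‖ ≤ 1 / 2 := hR'4.trans (by norm_num)
  have hRR' : ‖R - R'‖ ≤ ‖(b₀ : 𝔸) - b₀'‖ + ‖(b₁ : 𝔸) - b₁'‖ := norm_ratio_sub_ratio_le h₀ h₀' h₁'
  -- `geo s b₀ b₁ − geo s b₀' b₁' = (b₀ − b₀') R'^s + b₀ (R^s − R'^s)`
  have hid : (geo s b₀ b₁ : 𝔸) - geo s b₀' b₁'
      = ((b₀ : 𝔸) - b₀') * upow s R' + (b₀ : 𝔸) * (upow s R - upow s R') := by
    simp only [geo, Units.val_mul, val_upowUnit, ← hRdef, ← hR'def]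
    noncomm_ring
  have hpow' : ‖upow s R'‖ ≤ 1 := by
    have hu : upow s R' ∈ unitary 𝔸 :=
      upow_mem_unitary ((unitaryUnits 𝔸).mul_mem ((unitaryUnits 𝔸).inv_mem h₀') h₁') hR'4 s
    exact (CStarRing.norm_of_mem_unitary hu).le
  rw [hid]
  calc ‖((b₀ : 𝔸) - b₀') * upow s R' + (b₀ : 𝔸) * (upow s R - upow s R')‖
        ≤ ‖((b₀ : 𝔸) - b₀') * upow s R'‖ + ‖(b₀ : 𝔸) * (upow s R - upow s R')‖ := norm_add_le _ _
    _ ≤ ‖(b₀ : 𝔸) - b₀'‖ * 1 + 6 * |s| * ‖R - R'‖ := by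
        gcongr
        · exact (norm_mul_le _ _).trans (by gcongr)
        · rw [CStarRing.norm_mem_unitary_mul _ (mem_unitaryUnits.mp h₀)]
          exact norm_upow_sub_upow_le_six hR hR' hs
    _ ≤ ‖(b₀ : 𝔸) - b₀'‖ * 1 + 6 * 1 * (‖(b₀ : 𝔸) - b₀'‖ + ‖(b₁ : 𝔸) - b₁'‖) := by
        gcongr
    _ ≤ 7 * (‖(b₀ : 𝔸) - b₀'‖ + ‖(b₁ : 𝔸) - b₁'‖) := by nlinarith [norm_nonneg ((b₁ : 𝔸) - b₁')]

end UnitaryGeo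

end

end Summit.QuantumFields.BalabanUV.T4Continuum.UnitaryGeodesic
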